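import Mathlib.Algebra.Polynomial.Inductions
import Mathlib.Algebra.Polynomial.Degree.Lemmas
import Mathlib.Algebra.Polynomial.Eval.Coeff
import Mathlib.Algebra.Order.BigOperators.Group.Finset
import Mathlib.Algebra.BigOperators.NatAntidiagonal
import Mathlib.Data.List.GetD
import Mathlib.Tactic.LinearCombination
import Mathlib.Tactic.GCongr
import HarnessLib

/-!
# Certified identities of integer polynomials by Kronecker substitution

Trunk-independent tool (topic `Algebra/Polynomial`). An identity `P = Q` between two explicit
univariate polynomial *expressions* with integer coefficients — sums, products and powers of
polynomials given by (possibly very long) coefficient lists — can be certified by the kernel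
without expanding anything: if every coefficient of `P` is bounded by `b₁` and every coefficient
of `Q` by `b₂` in absolute value, and `B > b₁ + b₂`, then `P(B) = Q(B)` in `ℤ` already forces
`P = Q`, because an integer polynomial all of whose coefficients are `< B` in absolute value and
which vanishes at `B` is zero (uniqueness of the balanced base-`B` expansion). This is Kronecker's
substitution (Kronecker 1882; von zur Gathen–Gerhard, *Modern Computer Algebra*, §8.4): the
evaluation at `B` packs a polynomial into one large integer, and the kernel's arbitrary-precision
arithmetic then checks the identity with a handful of big-integer operations (`decide +kernel`),
where `ring` would have to normalise `O(deg²)` coefficient products.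

## Main definitions and results

* `Literature.PolyCert.ofList R l`: the polynomial `l₀ + l₁ X + ⋯ + lₙ Xⁿ ∈ R[X]` of a list of integers
  (`coeff_ofList`, `natDegree_ofList_le`, `natDegree_ofList_eq`, `ofList_ne_zero`, `map_ofList`).
* `Literature.Algebra.Polynomial.PolyCert.PExpr`: the syntax of polynomial expressions (list literals, `X`, integer
  constants, `+`, `-`, unary `-`, `*`, `^`), with `PExpr.denote R : PExpr → R[X]`,
  the integer evaluation `PExpr.evalAt : PExpr → ℤ → ℤ` (`eval_denote`), a coefficient bound
  `PExpr.bound` and a length bound `PExpr.len` (`coeffBound_denote`: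
  `natDegree (denote e) < len e` and `|coeff k| ≤ bound e`).
* `Literature.Algebra.Polynomial.PolyCert.eq_zero_of_eval_eq_zero`: an integer polynomial with all `|coeff| < B` vanishing
  at `B` is zero; `Literature.Algebra.Polynomial.PolyCert.eq_of_eval_eq`: the resulting injectivity.
* `Literature.PolyCert.PExpr.check e₁ e₂ : Bool` — evaluates both sides at `B = bound e₁ + bound e₂ + 1` —
  and the soundness theorem `Literature.Algebra.Polynomial.PolyCert.PExpr.denote_eq_of_check`:
  `check e₁ e₂ = true → denote R e₁ = denote R e₂` in `R[X]` for every commutative ring `R`.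
* `Literature.Algebra.Polynomial.PolyCert.derivList`: coefficient list of the formal derivative (a convenience for naming
  polynomials such as `U′h − 2Uh′`; no property of it is used by the certificate).

Usage: `have key := PExpr.denote_eq_of_check (R := ℚ) (e₁ := E₁) (e₂ := E₂) (by decide +kernel)`,
then `simp only [PExpr.denote, …] at key` and close the polynomial goal by `linear_combination key`.
First client: the explicit cyclic isogenies of degree `7, …, 163` of the CM curves over `ℚ`
(`Literature.NumberTheory.EllipticCurves.ComplexMultiplicationTwistIsogenyModelsProofs`), whose
defining identities have degree up to `489` and coefficients of up to `1500` digits.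

## References

* J. von zur Gathen, J. Gerhard, *Modern Computer Algebra*, 3rd ed., CUP (2013), §8.4
  (Kronecker substitution). The mathematics here is elementary and self-contained. [folklore]
-/

namespace Literature.Algebra.Polynomial.PolyCert

open _root_.Polynomial Finset

/-! ### Polynomials from coefficient lists -/

section OfList

variable (R : Type*) [CommRing R]

/-- `ofList R [a₀, a₁, …, aₙ] = a₀ + a₁ X + ⋯ + aₙ Xⁿ ∈ R[X]` (integer coefficients cast into
`R`). [folklore] -/
private noncomputable def _root_.Literature.NumberTheory.EllipticCurves.PolyCert.ofList : List ℤ → R[X]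
  | [] => 0
  | a :: l => C (a : R) + X * Literature.NumberTheory.EllipticCurves.PolyCert.ofList l

/-- `ofList R [] = 0`. [folklore] -/
@[simp] private theorem _root_.Literature.NumberTheory.EllipticCurves.PolyCert.ofList_nil : Literature.NumberTheory.EllipticCurves.PolyCert.ofList R [] = 0 := rfl

/-- `ofList R (a :: l) = a + X · ofList R l`. [folklore] -/
@[simp] private theorem _root_.Literature.NumberTheory.EllipticCurves.PolyCert.ofList_cons (a : ℤ) (l : List ℤ) :
    Literature.NumberTheory.EllipticCurves.PolyCert.ofList R (a :: l) = C (a : R) + X * Literature.NumberTheory.EllipticCurves.PolyCert.ofList R l := rfl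

/-- The `k`-th coefficient of `ofList R l` is the `k`-th entry of `l` (zero beyond the end).
[folklore] -/
private theorem _root_.Literature.NumberTheory.EllipticCurves.PolyCert.coeff_ofList : ∀ (l : List ℤ) (k : ℕ), (Literature.NumberTheory.EllipticCurves.PolyCert.ofList R l).coeff k = ((l.getD k 0 : ℤ) : R)
  | [], k => by simp
  | a :: l, 0 => by simp
  | a :: l, k + 1 => by
    rw [Literature.NumberTheory.EllipticCurves.PolyCert.ofList_cons, coeff_add, coeff_C_succ, coeff_X_mul, zero_add, Literature.NumberTheory.EllipticCurves.PolyCert.coeff_ofList l k,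
      List.getD_cons_succ]

/-- `natDegree (ofList R l) ≤ length l - 1`. [folklore] -/
private theorem _root_.Literature.NumberTheory.EllipticCurves.PolyCert.natDegree_ofList_le (l : List ℤ) : (Literature.NumberTheory.EllipticCurves.PolyCert.ofList R l).natDegree ≤ l.length - 1 := by
  rw [natDegree_le_iff_coeff_eq_zero]
  intro N hN
  rw [Literature.NumberTheory.EllipticCurves.PolyCert.coeff_ofList, List.getD_eq_default _ _ (by omega), Int.cast_zero]

/-- `natDegree (ofList R l) < max 1 (length l)`. [folklore] -/
theorem natDegree_ofList_lt (l : List ℤ) : (Literature.NumberTheory.EllipticCurves.PolyCert.ofList R l).natDegree < max 1 l.length := by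
  have := Literature.NumberTheory.EllipticCurves.PolyCert.natDegree_ofList_le R l
  omega

/-- If the last entry of `l` is non-zero in `R` — over a ring of characteristic zero, if it is a
non-zero integer — then `natDegree (ofList R l) = length l - 1`. [folklore] -/
theorem natDegree_ofList_eq [CharZero R] (l : List ℤ) (n : ℕ) (hn : l.length = n + 1)
    (h : l.getD n 0 ≠ 0) : (Literature.NumberTheory.EllipticCurves.PolyCert.ofList R l).natDegree = n := by
  refine natDegree_eq_of_le_of_coeff_ne_zero ?_ ?_
  · have := Literature.NumberTheory.EllipticCurves.PolyCert.natDegree_ofList_le R l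
    omega
  · rw [Literature.NumberTheory.EllipticCurves.PolyCert.coeff_ofList]
    exact_mod_cast h

/-- A list with a non-zero last entry gives a non-zero polynomial (characteristic zero).
[folklore] -/
private theorem _root_.Literature.NumberTheory.EllipticCurves.PolyCert.ofList_ne_zero [CharZero R] (l : List ℤ) (n : ℕ) (h : l.getD n 0 ≠ 0) :
    Literature.NumberTheory.EllipticCurves.PolyCert.ofList R l ≠ 0 := by
  intro h0
  have := congrArg (fun p : R[X] => p.coeff n) h0
  simp only [Literature.NumberTheory.EllipticCurves.PolyCert.coeff_ofList, coeff_zero, Int.cast_eq_zero] at this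
  exact h this

/-- `ofList` commutes with base change from `ℤ`. [folklore] -/
theorem map_ofList (l : List ℤ) : (Literature.NumberTheory.EllipticCurves.PolyCert.ofList ℤ l).map (Int.castRingHom R) = Literature.NumberTheory.EllipticCurves.PolyCert.ofList R l := by
  induction l with
  | nil => simp
  | cons a l ih =>
    rw [Literature.NumberTheory.EllipticCurves.PolyCert.ofList_cons, Literature.NumberTheory.EllipticCurves.PolyCert.ofList_cons, Polynomial.map_add, Polynomial.map_mul, Polynomial.map_X,
      Polynomial.map_C, ih]
    simp

end OfList

/-! ### Coefficient bounds -/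

/-- `CoeffBound p L b`: the integer polynomial `p` has fewer than `L` coefficients
(`natDegree p < L`) and all of them are bounded by `b` in absolute value. [folklore] -/
def CoeffBound (p : ℤ[X]) (L b : ℕ) : Prop :=
  p.natDegree < L ∧ ∀ k, (p.coeff k).natAbs ≤ b

namespace CoeffBound

variable {p q : ℤ[X]} {L L' b b' : ℕ}

/-- Coefficients beyond the length bound vanish. [folklore] -/
theorem coeff_eq_zero (h : CoeffBound p L b) {k : ℕ} (hk : L ≤ k) : p.coeff k = 0 :=
  coeff_eq_zero_of_natDegree_lt (lt_of_lt_of_le h.1 hk)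

/-- The length bound is positive. [folklore] -/
theorem one_le (h : CoeffBound p L b) : 1 ≤ L := Nat.one_le_of_lt h.1

/-- Weakening. [folklore] -/
theorem mono (h : CoeffBound p L b) (hL : L ≤ L') (hb : b ≤ b') : CoeffBound p L' b' :=
  ⟨lt_of_lt_of_le h.1 hL, fun k => (h.2 k).trans hb⟩

/-- Bound for a list literal. [folklore] -/
theorem ofList (l : List ℤ) (b : ℕ) (hb : ∀ a ∈ l, a.natAbs ≤ b) :
    CoeffBound (Literature.NumberTheory.EllipticCurves.PolyCert.ofList ℤ l) (max 1 l.length) b := by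
  refine ⟨natDegree_ofList_lt ℤ l, fun k => ?_⟩
  rw [Literature.NumberTheory.EllipticCurves.PolyCert.coeff_ofList, Int.cast_id]
  by_cases hk : k < l.length
  · have hmem : l.getD k 0 ∈ l := by
      rw [List.getD_eq_getElem _ _ hk]
      exact List.getElem_mem hk
    exact hb _ hmem
  · rw [List.getD_eq_default _ _ (by omega)]
    simp

/-- Bound for `X`. [folklore] -/
theorem X : CoeffBound (X : ℤ[X]) 2 1 := by
  refine ⟨lt_of_le_of_lt natDegree_X_le one_lt_two, fun k => ?_⟩
  rw [coeff_X]
  split_ifs <;> simp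

/-- Bound for a constant. [folklore] -/
theorem C (a : ℤ) : CoeffBound (C a) 1 a.natAbs := by
  refine ⟨by rw [natDegree_C]; exact one_pos, fun k => ?_⟩
  rw [coeff_C]
  split_ifs <;> simp

/-- Bound for a sum. [folklore] -/
theorem add (hp : CoeffBound p L b) (hq : CoeffBound q L' b') :
    CoeffBound (p + q) (max L L') (b + b') := by
  refine ⟨lt_of_le_of_lt (natDegree_add_le p q) (max_lt_max hp.1 hq.1) |>.trans_le' ?_, fun k => ?_⟩
  · exact le_rfl
  · rw [coeff_add]
    exact (Int.natAbs_add_le _ _).trans (Nat.add_le_add (hp.2 k) (hq.2 k))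

/-- Bound for a negation. [folklore] -/
theorem neg (hp : CoeffBound p L b) : CoeffBound (-p) L b :=
  ⟨by rw [natDegree_neg]; exact hp.1, fun k => by rw [coeff_neg, Int.natAbs_neg]; exact hp.2 k⟩

/-- Bound for a difference. [folklore] -/
theorem sub (hp : CoeffBound p L b) (hq : CoeffBound q L' b') :
    CoeffBound (p - q) (max L L') (b + b') := by
  rw [sub_eq_add_neg]
  exact hp.add hq.neg

/-- Partial sums of absolute values of coefficients: `∑_{i < m} |p_i| ≤ L · b`. [folklore] -/
theorem sum_natAbs_le (hp : CoeffBound p L b) (m : ℕ) :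
    ∑ i ∈ range m, (p.coeff i).natAbs ≤ L * b := by
  classical
  have hsplit : ∑ i ∈ range m, (p.coeff i).natAbs =
      ∑ i ∈ (range m).filter (· < L), (p.coeff i).natAbs := by
    rw [Finset.sum_filter]
    refine Finset.sum_congr rfl fun i _ => ?_
    split_ifs with hi
    · rfl
    · rw [hp.coeff_eq_zero (not_lt.mp hi), Int.natAbs_zero]
  rw [hsplit]
  calc ∑ i ∈ (range m).filter (· < L), (p.coeff i).natAbs
      ≤ ∑ _i ∈ (range m).filter (· < L), b := Finset.sum_le_sum fun i _ => hp.2 i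
    _ = ((range m).filter (· < L)).card * b := by rw [Finset.sum_const, smul_eq_mul]
    _ ≤ (range L).card * b := by
        gcongr
        intro i hi
        simp only [Finset.mem_filter, Finset.mem_range] at hi ⊢
        exact hi.2
    _ = L * b := by rw [Finset.card_range]

/-- Bound for a product: `|(pq)_k| ≤ ∑_{i+j=k} |p_i| |q_j| ≤ (L·b)·b'`, and
`natDegree (pq) ≤ natDegree p + natDegree q < L + L' - 1`. [folklore] -/
theorem mul (hp : CoeffBound p L b) (hq : CoeffBound q L' b') :
    CoeffBound (p * q) (L + L' - 1) (L * b * b') := by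
  refine ⟨?_, fun k => ?_⟩
  · have h1 := hp.1
    have h2 := hq.1
    have := natDegree_mul_le (p := p) (q := q)
    omega
  · rw [coeff_mul]
    calc (∑ x ∈ antidiagonal k, p.coeff x.1 * q.coeff x.2).natAbs
        ≤ ∑ x ∈ antidiagonal k, (p.coeff x.1 * q.coeff x.2).natAbs := Int.natAbs_sum_le _ _
      _ = ∑ x ∈ antidiagonal k, (p.coeff x.1).natAbs * (q.coeff x.2).natAbs := by
          simp_rw [Int.natAbs_mul]
      _ ≤ ∑ x ∈ antidiagonal k, (p.coeff x.1).natAbs * b' :=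
          Finset.sum_le_sum fun x _ => Nat.mul_le_mul_left _ (hq.2 _)
      _ = (∑ x ∈ antidiagonal k, (p.coeff x.1).natAbs) * b' := by rw [Finset.sum_mul]
      _ = (∑ i ∈ range k.succ, (p.coeff i).natAbs) * b' := by
          rw [Finset.Nat.sum_antidiagonal_eq_sum_range_succ (fun i _ => (p.coeff i).natAbs) k]
      _ ≤ L * b * b' := Nat.mul_le_mul_right _ (hp.sum_natAbs_le _)

/-- Length bound of the `n`-th power of a polynomial with length bound `L`. [folklore] -/
def powLen (L n : ℕ) : ℕ := n * (L - 1) + 1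

/-- Coefficient bound of the `n`-th power, following `p ^ (n+1) = p ^ n * p`. [folklore] -/
def powBound (L b : ℕ) : ℕ → ℕ
  | 0 => 1
  | n + 1 => powLen L n * powBound L b n * b

/-- Bound for a power. [folklore] -/
theorem pow (hp : CoeffBound p L b) : ∀ n : ℕ, CoeffBound (p ^ n) (powLen L n) (powBound L b n)
  | 0 => by
    rw [pow_zero, powLen, powBound, zero_mul, zero_add]
    simpa using CoeffBound.C 1
  | n + 1 => by
    rw [pow_succ]
    have h := (pow hp n).mul hp
    refine h.mono ?_ le_rfl
    have := hp.one_le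
    simp only [powLen]
    cases L with
    | zero => omega
    | succ L => simp only [Nat.succ_sub_one]; ring_nf; omega

end CoeffBound

/-! ### Injectivity of the evaluation at a large integer -/

/-- **Uniqueness of the balanced base-`B` expansion.** An integer polynomial all of whose
coefficients are `< B` in absolute value and which vanishes at `B` is zero. [folklore] -/
theorem eq_zero_of_eval_eq_zero (B : ℕ) :
    ∀ (n : ℕ) (r : ℤ[X]), r.natDegree ≤ n → (∀ k, (r.coeff k).natAbs < B) →
      r.eval (B : ℤ) = 0 → r = 0
  | 0, r, hn, hB, h => by
    rw [eq_C_of_natDegree_le_zero hn] at h ⊢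
    rw [eval_C] at h
    rw [h, map_zero]
  | n + 1, r, hn, hB, h => by
    -- `r = divX r * X + C (r.coeff 0)`
    have hr := divX_mul_X_add r
    have h0 : r.coeff 0 = 0 := by
      have hdvd : (B : ℤ) ∣ r.coeff 0 := by
        refine ⟨-(r.divX.eval (B : ℤ)), ?_⟩
        have := congrArg (eval (B : ℤ)) hr
        rw [eval_add, eval_mul, eval_X, eval_C, h] at this
        linear_combination this
      refine Int.eq_zero_of_dvd_of_natAbs_lt_natAbs hdvd ?_
      rw [Int.natAbs_natCast]
      exact hB 0
    have hB0 : (B : ℤ) ≠ 0 := by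
      have := hB 0
      exact_mod_cast (Nat.pos_of_ne_zero (by omega) : 0 < B).ne'
    have hdiv : r.divX = 0 := by
      refine eq_zero_of_eval_eq_zero B n r.divX ?_ (fun k => ?_) ?_
      · rw [natDegree_divX_eq_natDegree_tsub_one]; omega
      · rw [coeff_divX]; exact hB _
      · have := congrArg (eval (B : ℤ)) hr
        rw [eval_add, eval_mul, eval_X, eval_C, h, h0, add_zero] at this
        exact (mul_eq_zero.mp this).resolve_right hB0
    rw [← hr, hdiv, h0, zero_mul, zero_add, map_zero]

/-- **Kronecker substitution is injective on bounded polynomials.** If the coefficients of `p`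
and `q` are bounded by `b` and `b'` in absolute value, `b + b' < B`, and `p(B) = q(B)`, then
`p = q`. [folklore] -/
theorem eq_of_eval_eq {p q : ℤ[X]} {b b' B : ℕ} (hp : ∀ k, (p.coeff k).natAbs ≤ b)
    (hq : ∀ k, (q.coeff k).natAbs ≤ b') (hB : b + b' < B)
    (h : p.eval (B : ℤ) = q.eval (B : ℤ)) : p = q := by
  rw [← sub_eq_zero]
  refine eq_zero_of_eval_eq_zero B _ (p - q) le_rfl (fun k => ?_) ?_
  · rw [coeff_sub]
    calc (p.coeff k - q.coeff k).natAbs ≤ (p.coeff k).natAbs + (q.coeff k).natAbs :=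
          Int.natAbs_sub_le _ _
      _ ≤ b + b' := Nat.add_le_add (hp k) (hq k)
      _ < B := hB
  · rw [eval_sub, h, sub_self]

/-! ### Polynomial expressions and the certificate -/

/-- Syntax of univariate polynomial expressions with integer coefficients: coefficient-list
literals, the variable, integer constants, sums, differences, negations, products and powers.
[folklore] -/
inductive PExpr : Type
  | lit : List ℤ → PExpr
  | X : PExpr
  | const : ℤ → PExpr
  | add : PExpr → PExpr → PExpr
  | sub : PExpr → PExpr → PExpr
  | neg : PExpr → PExpr
  | mul : PExpr → PExpr → PExpr
  | pow : PExpr → ℕ → PExpr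

namespace PExpr

/-- The polynomial over `R` denoted by an expression. [folklore] -/
noncomputable def denote (R : Type*) [CommRing R] : PExpr → R[X]
  | lit l => Literature.NumberTheory.EllipticCurves.PolyCert.ofList R l
  | X => Polynomial.X
  | const a => Polynomial.C (a : R)
  | add e₁ e₂ => denote R e₁ + denote R e₂
  | sub e₁ e₂ => denote R e₁ - denote R e₂
  | neg e => -denote R e
  | mul e₁ e₂ => denote R e₁ * denote R e₂
  | pow e n => denote R e ^ n

/-- Horner evaluation of a coefficient list at an integer. [folklore] -/
def horner : List ℤ → ℤ → ℤ
  | [], _ => 0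
  | a :: l, x => a + x * horner l x

/-- Evaluation of an expression at an integer (mirrors `denote`). [folklore] -/
def evalAt : PExpr → ℤ → ℤ
  | lit l, x => horner l x
  | X, x => x
  | const a, _ => a
  | add e₁ e₂, x => evalAt e₁ x + evalAt e₂ x
  | sub e₁ e₂, x => evalAt e₁ x - evalAt e₂ x
  | neg e, x => -evalAt e x
  | mul e₁ e₂, x => evalAt e₁ x * evalAt e₂ x
  | pow e n, x => evalAt e x ^ n

/-- A bound for the number of coefficients: `natDegree (denote e) < len e`. [folklore] -/
def len : PExpr → ℕ
  | lit l => max 1 l.length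
  | X => 2
  | const _ => 1
  | add e₁ e₂ => max (len e₁) (len e₂)
  | sub e₁ e₂ => max (len e₁) (len e₂)
  | neg e => len e
  | mul e₁ e₂ => len e₁ + len e₂ - 1
  | pow e n => CoeffBound.powLen (len e) n

/-- The largest absolute value of an entry of a list of integers. [folklore] -/
def maxAbs : List ℤ → ℕ
  | [] => 0
  | a :: l => max a.natAbs (maxAbs l)

/-- A bound for the absolute values of the coefficients of `denote e`. [folklore] -/
def bound : PExpr → ℕ
  | lit l => maxAbs l
  | X => 1
  | const a => a.natAbs
  | add e₁ e₂ => bound e₁ + bound e₂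
  | sub e₁ e₂ => bound e₁ + bound e₂
  | neg e => bound e
  | mul e₁ e₂ => len e₁ * bound e₁ * bound e₂
  | pow e n => CoeffBound.powBound (len e) (bound e) n

/-- **The certificate**: evaluate both sides at `B = bound e₁ + bound e₂ + 1`. [folklore] -/
def check (e₁ e₂ : PExpr) : Bool :=
  evalAt e₁ ((bound e₁ + bound e₂ + 1 : ℕ) : ℤ) == evalAt e₂ ((bound e₁ + bound e₂ + 1 : ℕ) : ℤ)

/-- Entries are bounded by `maxAbs`. [folklore] -/
theorem natAbs_le_maxAbs : ∀ (l : List ℤ), ∀ a ∈ l, a.natAbs ≤ maxAbs l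
  | [], a, h => (List.not_mem_nil h).elim
  | b :: l, a, h => by
    rw [maxAbs]
    rcases List.mem_cons.mp h with rfl | h
    · exact le_max_left _ _
    · exact (natAbs_le_maxAbs l a h).trans (le_max_right _ _)

/-- `denote e` has fewer than `len e` coefficients, all bounded by `bound e`. [folklore] -/
theorem coeffBound_denote : ∀ e : PExpr, CoeffBound (denote ℤ e) (len e) (bound e)
  | lit l => CoeffBound.ofList l _ (natAbs_le_maxAbs l)
  | X => CoeffBound.X
  | const a => by simp only [denote, len, bound, Int.cast_id]; exact CoeffBound.C a
  | add e₁ e₂ => (coeffBound_denote e₁).add (coeffBound_denote e₂)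
  | sub e₁ e₂ => (coeffBound_denote e₁).sub (coeffBound_denote e₂)
  | neg e => (coeffBound_denote e).neg
  | mul e₁ e₂ => (coeffBound_denote e₁).mul (coeffBound_denote e₂)
  | pow e n => (coeffBound_denote e).pow n

/-- Horner evaluation is evaluation of `ofList`. [folklore] -/
theorem eval_ofList (x : ℤ) : ∀ l : List ℤ, (Literature.NumberTheory.EllipticCurves.PolyCert.ofList ℤ l).eval x = horner l x
  | [] => by simp [horner]
  | a :: l => by
    rw [Literature.NumberTheory.EllipticCurves.PolyCert.ofList_cons, eval_add, eval_C, eval_mul, eval_X, eval_ofList x l, horner, Int.cast_id]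

/-- `evalAt` is evaluation of `denote`. [folklore] -/
theorem eval_denote (x : ℤ) : ∀ e : PExpr, (denote ℤ e).eval x = evalAt e x
  | lit l => eval_ofList x l
  | X => by simp [denote, evalAt]
  | const a => by simp [denote, evalAt]
  | add e₁ e₂ => by simp [denote, evalAt, eval_denote x e₁, eval_denote x e₂]
  | sub e₁ e₂ => by simp [denote, evalAt, eval_denote x e₁, eval_denote x e₂]
  | neg e => by simp [denote, evalAt, eval_denote x e]
  | mul e₁ e₂ => by simp [denote, evalAt, eval_denote x e₁, eval_denote x e₂]
  | pow e n => by simp [denote, evalAt, eval_denote x e]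

/-- `denote` commutes with base change from `ℤ`. [folklore] -/
theorem map_denote (R : Type*) [CommRing R] :
    ∀ e : PExpr, (denote ℤ e).map (Int.castRingHom R) = denote R e
  | lit l => map_ofList R l
  | X => by simp [denote]
  | const a => by simp [denote]
  | add e₁ e₂ => by simp [denote, map_denote R e₁, map_denote R e₂]
  | sub e₁ e₂ => by simp [denote, map_denote R e₁, map_denote R e₂]
  | neg e => by simp [denote, map_denote R e]
  | mul e₁ e₂ => by simp [denote, map_denote R e₁, map_denote R e₂]
  | pow e n => by simp [denote, map_denote R e]

/-- **Soundness of the Kronecker certificate.** If `check e₁ e₂ = true` then the two expressions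
denote the same polynomial over every commutative ring. [folklore] -/
theorem denote_eq_of_check (R : Type*) [CommRing R] {e₁ e₂ : PExpr} (h : check e₁ e₂ = true) :
    denote R e₁ = denote R e₂ := by
  have hZ : denote ℤ e₁ = denote ℤ e₂ := by
    refine eq_of_eval_eq (coeffBound_denote e₁).2 (coeffBound_denote e₂).2 (Nat.lt_succ_self _) ?_
    rw [eval_denote, eval_denote]
    simpa [check] using h
  rw [← map_denote R e₁, ← map_denote R e₂, hZ]

end PExpr

/-! ### Formal derivative of a coefficient list -/

/-- Auxiliary: `derivAux k [a₀, a₁, …] = [k a₀, (k+1) a₁, …]`. [folklore] -/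
def derivAux : ℕ → List ℤ → List ℤ
  | _, [] => []
  | k, a :: l => (k : ℤ) * a :: derivAux (k + 1) l

/-- Coefficient list of the formal derivative: `derivList [a₀, a₁, a₂, …] = [a₁, 2a₂, 3a₃, …]`.
Only used to *name* polynomials (e.g. `U′h − 2Uh′`); the certificate treats the result as data.
[folklore] -/
def derivList (l : List ℤ) : List ℤ :=
  derivAux 1 l.tail

end Literature.Algebra.Polynomial.PolyCert
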